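import Literature.Computability.Complexity.AdaptiveFunctions
import Literature.Computability.Complexity.OracleClosure
import Literature.Computability.Complexity.OracleJoin
import Literature.Computability.Cryptography.VanDamSeroussiOracleFP
import HarnessLib

/-!
# The factor-window transducer: read the prime factorisation of a number bit by bit from a factor-bit
# oracle, then ask ONE query to a second oracle

A generic form of the classical adaptive transducer of the `3 ∣ h` / unit-signature lines (Ladner–Lynch–
Selman 1975, §2; Arora–Barak 2009, §17.2.1 "computing a function bit by bit with a decision oracle").
Data: a number map `num` (read off the input `z`), a final-query map `fin (z, F)` of the input and a list
of numbers, and a guard bit `ok z`, all in the typed `CodeFP` algebra. Against the join `FB ⊕ CU` of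

* a FACTOR-BIT language `FB` (`⟨bin N, u⟩ ∈ FB ↔` bit `|u|` of `code(primeFactorsList N)` is `1`) and
* any language `CU`,

the transducer `adFn Q (p+1) G (FB ⊕ CU)` asks `0·⟨bin (num z), 1ⁱ⟩` for `i < p(|z|)` — the answers
spell the zero-padded window of `code(primeFactorsList (num z))` (`adBits_window`) —, parses the factor
list `F` back (`VDSOracle.parseF_certCode_append`), asks ONCE `1·fin(z, F)` and outputs
`[ok z ∧ answer]` (`adFn_eq`). Both classical maps are in `FP` (`exists_queryFn`, `exists_outFn`); with
the window bound `p = 2(|z|+1)²` (valid when `|bin (num z)| ≤ |z|`, `length_certCode_primeFactorsList_le`)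
this packages as **`exists_transducer`**: an `FP^{FB ⊕ CU}` function `T` with
`T z = [ok z ∧ (fin (z, primeFactorsList (num z)) ∈ CU)]` for EVERY `z`.

## References

* R. E. Ladner, N. A. Lynch, A. L. Selman, *A comparison of polynomial time reducibilities*,
  Theoret. Comput. Sci. 1 (1975), §2 [LadnerLynchSelman1975].
* S. Arora, B. Barak, *Computational Complexity: A Modern Approach*, CUP 2009, §1.3, §17.2.1
  [AroraBarak2009].
-/

namespace Literature.Computability.Cryptography

namespace FactorWindow

open _root_.Computability Polynomial
open Literature.Computability.Complexity Literature.Computability.Complexity.Brick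
  Literature.Computability.Complexity.CodeFP Literature.Computability.Complexity.AdQuery
open VDSOracle (certCode parseF parseF_certCode_append codeFP_parseF)

/-! ### Answer strings of prefix-reading queries -/

/-- **Answer strings that read a fixed string bit by bit**: if, while fewer than `|W|` answers are in,
the answer to the query computed from the `i`-prefix of `W` is bit `i` of `W`, then after `i ≤ |W|`
rounds the answer string is the `i`-prefix of `W`. -- adapted from the unit-signature line
(`AvgFaceBeyondPrior.Mirror.adBits_eq_take`) [cite: AroraBarak2009, §17.2.1] -/
private theorem adBits_eq_take {Q : List Bool → List Bool} {A : Language Bool} {x W : List Bool}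
    (h : ∀ i < W.length, A.boolIndicator (Q (boolPair x (W.take i))) = W.getD i false) :
    ∀ i ≤ W.length, adBits Q A x i = W.take i
  | 0, _ => by simp
  | i + 1, hi => by
    rw [adBits_succ, adBits_eq_take h i (Nat.le_of_succ_le hi), h i hi, List.take_add_one,
      List.getD_eq_getElem?_getD, List.getElem?_eq_getElem hi]
    rfl

/-! ### The window bound -/

/-- `|code(primeFactorsList n)| ≤ 2(|bin n| + 1)²`: at most `|bin n|` factors of at most `|bin n|` bits
each. -- adapted from `AvgFaceBeyondPrior.Mirror.length_certCode_primeFactorsList_le` [folklore] -/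
private theorem length_certCode_primeFactorsList_le (n : ℕ) :
    (certCode n.primeFactorsList).length ≤ 2 * ((encodeNat n).length + 1) ^ 2 := by
  have hm : (encodeNat n).length = n.size := TM2Pass.length_encodeNat_eq_size n
  have hF : n.primeFactorsList.length ≤ (encodeNat n).length := by
    rcases Nat.eq_zero_or_pos n with rfl | hn
    · simp
    · have h1 := List.pow_card_le_prod n.primeFactorsList 2 fun x hx =>
        (Nat.prime_of_mem_primeFactorsList hx).two_le
      rw [Nat.prod_primeFactorsList hn.ne'] at h1
      have h2 : n < 2 ^ n.size := Nat.lt_size_self n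
      have h3 := (Nat.pow_lt_pow_iff_right (by norm_num : 1 < 2)).1 (h1.trans_lt h2)
      omega
  have hitem : ∀ a ∈ n.primeFactorsList, 2 * (natE a).length + 2 ≤ 2 * (encodeNat n).length + 2 := by
    intro a ha
    have : (natE a).length ≤ (encodeNat n).length := by
      rw [natE, TM2Pass.length_encodeNat_eq_size, hm]
      exact Nat.size_le_size (Nat.le_of_mem_primeFactorsList ha)
    omega
  have hsum := List.sum_le_card_nsmul _ _ fun x hx => by
    obtain ⟨a, ha, rfl⟩ := List.mem_map.1 hx
    exact hitem a ha
  rw [List.length_map, smul_eq_mul] at hsum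
  rw [certCode, listE, length_boolPair, length_unE, length_rawE]
  set m := (encodeNat n).length
  set k := n.primeFactorsList.length
  have hk : k * (2 * m + 2) ≤ m * (2 * m + 2) := Nat.mul_le_mul_right _ hF
  nlinarith [hsum, hk]

/-- The window polynomial `2(X+1)²` bounds the code of the factor list of `num z` when
`|bin (num z)| ≤ |z|`. [folklore] -/
theorem window_bound {num : List Bool → ℕ} (hnum : ∀ z, (encodeNat (num z)).length ≤ z.length) (z : List Bool) :
    (certCode (num z).primeFactorsList).length ≤ (2 * (X + 1) ^ 2 : Polynomial ℕ).eval z.length := by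
  refine (length_certCode_primeFactorsList_le (num z)).trans ?_
  simp only [eval_mul, eval_ofNat, eval_pow, eval_add, eval_X, eval_one]
  have := hnum z
  gcongr

/-! ### The two classical maps are polynomial time -/

section Maps

variable {num : List Bool → ℕ} {fin : List Bool × List ℕ → List Bool} {ok : List Bool → Bool}

/-- **The query generator is in `FP`**: while fewer than `p(|z|)` answers are in, the factor-bit query
`0·⟨bin (num z), 1^{#answers}⟩`; afterwards the final query `1·fin(z, F)` with `F` parsed from the first
`p(|z|)` answers. -- adapted from `AvgFaceBeyondPrior.Mirror.exists_queryFn` [cite: AroraBarak2009, §1.3] -/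
theorem exists_queryFn (hnum : CodeFP strE natE num) (hfin : CodeFP (pairE strE (rawE natE)) strE fin)
    (p : Polynomial ℕ) :
    ∃ Q : List Bool → List Bool, Q ∈ FP ∧ ∀ x ans : List Bool, Q (boolPair x ans) =
      if ans.length < p.eval x.length then false :: boolPair (encodeNat (num x)) (unE ans.length)
      else true :: fin (x, parseF (ans.take (p.eval x.length))) := by
  have hx : CodeFP strE strE fstF := of_fn fstF fstF_mem_FP fun _ => rfl
  have hb : CodeFP strE strE sndF := of_fn sndF sndF_mem_FP fun _ => rfl
  have hpoly : CodeFP strE unE (fun w => p.eval w.length) :=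
    of_fn (Plumb.polyFn p) (Plumb.polyFn_mem_FP p) fun w => by rw [Plumb.polyFn_apply, unE_eq_ones]; rfl
  have hP : CodeFP strE unE (fun z => p.eval (fstF z).length) := hpoly.comp hx
  have hlen : CodeFP strE unE (fun z => (sndF z).length) := strLength.comp hb
  have hlt : CodeFP strE bitE (fun z => decide ((sndF z).length < p.eval (fstF z).length)) :=
    natLt.comp ((natOfUn.comp hlen).pair (natOfUn.comp hP))
  have hq1 : CodeFP strE strE (fun z => boolPair (encodeNat (num (fstF z))) (unE (sndF z).length)) :=
    ((hnum.comp hx).pair (strOfUn.comp hlen)).recodeOut fun _ => rfl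
  have hcons : ∀ b : Bool, CodeFP strE strE (List.cons b) := fun b =>
    of_fn (List.cons b) (cons_mem_FP b) fun _ => rfl
  have h1 : CodeFP strE strE (fun z => false :: boolPair (encodeNat (num (fstF z))) (unE (sndF z).length)) :=
    (hcons false).comp hq1
  have hq2 : CodeFP strE strE (fun z => fin (fstF z, parseF ((sndF z).take (p.eval (fstF z).length)))) :=
    hfin.comp (hx.pair (codeFP_parseF.comp (strTake.comp (hP.pair hb))))
  have h2 : CodeFP strE strE (fun z => true :: fin (fstF z, parseF ((sndF z).take (p.eval (fstF z).length)))) :=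
    (hcons true).comp hq2
  obtain ⟨Q, hQ, hQeq⟩ := hlt.ite h1 h2
  refine ⟨Q, hQ, fun x ans => ?_⟩
  have h := hQeq (boolPair x ans)
  simp only [strE, id, fstF_boolPair, sndF_boolPair] at h
  rw [h]
  by_cases hc : ans.length < p.eval x.length
  · rw [if_pos hc, decide_eq_true hc, if_pos rfl]
  · rw [if_neg hc, decide_eq_false hc, if_neg Bool.false_ne_true]

/-- **The output map is in `FP`**: the one-bit string `[ok z ∧ answer number p(|z|)]`.
-- adapted from `AvgFaceBeyondPrior.Mirror.exists_outFn` [cite: AroraBarak2009, §1.3] -/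
theorem exists_outFn (hok : CodeFP strE bitE ok) (p : Polynomial ℕ) :
    ∃ G : List Bool → List Bool, G ∈ FP ∧ ∀ x bits : List Bool, G (boolPair x bits) =
      [ok x && bits.getD (p.eval x.length) false] := by
  have hx : CodeFP strE strE fstF := of_fn fstF fstF_mem_FP fun _ => rfl
  have hb : CodeFP strE strE sndF := of_fn sndF sndF_mem_FP fun _ => rfl
  have hpoly : CodeFP strE unE (fun w => p.eval w.length) :=
    of_fn (Plumb.polyFn p) (Plumb.polyFn_mem_FP p) fun w => by rw [Plumb.polyFn_apply, unE_eq_ones]; rfl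
  have hbit : CodeFP strE bitE (fun z => (sndF z).getD (p.eval (fstF z).length) false) :=
    strGetD.comp ((hpoly.comp hx).pair hb)
  have hout : CodeFP strE strE (fun z => [ok (fstF z) && (sndF z).getD (p.eval (fstF z).length) false]) :=
    ((hok.comp hx).and hbit).recodeOut fun _ => rfl
  obtain ⟨G, hG, hGeq⟩ := hout
  refine ⟨G, hG, fun x bits => ?_⟩
  have h := hGeq (boolPair x bits)
  simp only [strE, id, fstF_boolPair, sndF_boolPair] at h
  exact h

end Maps

/-! ### The answer bits against `FB ⊕ CU` -/

section Transducer

variable {FB CU : Language Bool} {Q G : List Bool → List Bool} {p : Polynomial ℕ}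
  {num : List Bool → ℕ} {fin : List Bool × List ℕ → List Bool} {ok : List Bool → Bool}

/-- The zero-padded window has length `p(|z|)` under the window bound. [folklore] -/
theorem length_window (z : List Bool) (hc : (certCode (num z).primeFactorsList).length ≤ p.eval z.length) :
    (certCode (num z).primeFactorsList ++
      List.replicate (p.eval z.length - (certCode (num z).primeFactorsList).length) false).length = p.eval z.length := by
  rw [List.length_append, List.length_replicate]; omega

/-- **The first `p(|z|)` answers are the zero-padded window of the factor-list code of `num z`.**
-- adapted from `AvgFaceBeyondPrior.Mirror.adBits_window` [cite: AroraBarak2009, §17.2.1] -/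
theorem adBits_window
    (hQ : ∀ x ans : List Bool, Q (boolPair x ans) =
      if ans.length < p.eval x.length then false :: boolPair (encodeNat (num x)) (unE ans.length)
      else true :: fin (x, parseF (ans.take (p.eval x.length))))
    (hFB : ∀ (N : ℕ) (u : List Bool),
      boolPair (encodeNat N) u ∈ FB ↔ (certCode N.primeFactorsList).getD u.length false = true)
    (z : List Bool) (hc : (certCode (num z).primeFactorsList).length ≤ p.eval z.length) :
    ∀ i ≤ p.eval z.length, adBits Q (oracleJoin FB CU) z i = (certCode (num z).primeFactorsList ++
      List.replicate (p.eval z.length - (certCode (num z).primeFactorsList).length) false).take i := by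
  have hW := length_window z hc
  intro i hi
  refine adBits_eq_take (fun j hj => ?_) i (hi.trans_eq hW.symm)
  rw [hQ, List.length_take_of_le hj.le, if_pos (by omega), boolIndicator_oracleJoin_false_cons]
  have hget : (certCode (num z).primeFactorsList ++
      List.replicate (p.eval z.length - (certCode (num z).primeFactorsList).length) false).getD j false =
        (certCode (num z).primeFactorsList).getD j false := by
    rw [List.getD_eq_getElem?_getD, List.getD_eq_getElem?_getD]
    by_cases hjc : j < (certCode (num z).primeFactorsList).length
    · rw [List.getElem?_append_left hjc]
    · rw [List.getElem?_append_right (not_lt.1 hjc), List.getElem?_eq_none (not_lt.1 hjc),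
        List.getElem?_replicate]
      split_ifs <;> rfl
  rw [hget]
  cases hb : (certCode (num z).primeFactorsList).getD j false
  · exact (Set.notMem_iff_boolIndicator _ _).1 fun hm => by
      have h1 := (hFB (num z) (unE j)).1 hm
      rw [length_unE, hb] at h1
      exact Bool.false_ne_true h1
  · exact (Set.mem_iff_boolIndicator _ _).1 ((hFB (num z) (unE j)).2 (by rw [length_unE, hb]))

/-- **The last answer is the `CU`-bit of the final query.** -- adapted from
`AvgFaceBeyondPrior.Mirror.adBits_last` [folklore] -/
theorem adBits_last
    (hQ : ∀ x ans : List Bool, Q (boolPair x ans) =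
      if ans.length < p.eval x.length then false :: boolPair (encodeNat (num x)) (unE ans.length)
      else true :: fin (x, parseF (ans.take (p.eval x.length))))
    (hFB : ∀ (N : ℕ) (u : List Bool),
      boolPair (encodeNat N) u ∈ FB ↔ (certCode N.primeFactorsList).getD u.length false = true)
    (z : List Bool) (hc : (certCode (num z).primeFactorsList).length ≤ p.eval z.length) :
    adBits Q (oracleJoin FB CU) z (p.eval z.length + 1) =
      (certCode (num z).primeFactorsList ++
          List.replicate (p.eval z.length - (certCode (num z).primeFactorsList).length) false) ++
        [CU.boolIndicator (fin (z, (num z).primeFactorsList))] := by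
  have hW := length_window z hc
  rw [adBits_succ, adBits_window hQ hFB z hc _ le_rfl, List.take_of_length_le hW.le, hQ, hW,
    if_neg (lt_irrefl _), List.take_of_length_le hW.le, parseF_certCode_append,
    boolIndicator_oracleJoin_true_cons]

/-- **The transducer computes `[ok z ∧ (fin (z, primeFactorsList (num z)) ∈ CU)]` on every input**,
given the window bound. -- adapted from `AvgFaceBeyondPrior.Mirror.adFn_eq_bit` [folklore] -/
theorem adFn_eq
    (hQ : ∀ x ans : List Bool, Q (boolPair x ans) =
      if ans.length < p.eval x.length then false :: boolPair (encodeNat (num x)) (unE ans.length)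
      else true :: fin (x, parseF (ans.take (p.eval x.length))))
    (hG : ∀ x bits : List Bool, G (boolPair x bits) = [ok x && bits.getD (p.eval x.length) false])
    (hFB : ∀ (N : ℕ) (u : List Bool),
      boolPair (encodeNat N) u ∈ FB ↔ (certCode N.primeFactorsList).getD u.length false = true)
    (hp : ∀ z : List Bool, (certCode (num z).primeFactorsList).length ≤ p.eval z.length) (z : List Bool) :
    adFn Q (p + 1) G (oracleJoin FB CU) z = [ok z && CU.boolIndicator (fin (z, (num z).primeFactorsList))] := by
  have hW := length_window z (hp z)
  rw [adFn_apply, eval_add, eval_one, adBits_last hQ hFB z (hp z), hG, List.getD_eq_getElem?_getD,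
    List.getElem?_append_right hW.le, hW, Nat.sub_self]
  rfl

end Transducer

/-! ### Package -/

/-- **The factor-window transducer as an `FP^{FB ⊕ CU}` function.** For `num, fin, ok` in the typed
`CodeFP` algebra with `|bin (num z)| ≤ |z|`, and a factor-bit language `FB`, there is
`T ∈ FP^{FB ⊕ CU}` with `T z = [ok z ∧ (fin (z, primeFactorsList (num z)) ∈ CU)]` for every `z`.
[cite: LadnerLynchSelman1975, §2] -/
theorem exists_transducer {FB CU : Language Bool} {num : List Bool → ℕ} {fin : List Bool × List ℕ → List Bool}
    {ok : List Bool → Bool} (hnum : CodeFP strE natE num) (hnum_le : ∀ z, (encodeNat (num z)).length ≤ z.length)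
    (hfin : CodeFP (pairE strE (rawE natE)) strE fin) (hok : CodeFP strE bitE ok)
    (hFB : ∀ (N : ℕ) (u : List Bool),
      boolPair (encodeNat N) u ∈ FB ↔ (certCode N.primeFactorsList).getD u.length false = true) :
    ∃ T : List Bool → List Bool, T ∈ FPRel (Oracle.ofLanguage (oracleJoin FB CU)) ∧
      ∀ z, T z = [ok z && CU.boolIndicator (fin (z, (num z).primeFactorsList))] := by
  obtain ⟨Q, hQfp, hQ⟩ := exists_queryFn hnum hfin (2 * (X + 1) ^ 2)
  obtain ⟨G, hGfp, hG⟩ := exists_outFn hok (2 * (X + 1) ^ 2)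
  exact ⟨adFn Q (2 * (X + 1) ^ 2 + 1) G (oracleJoin FB CU), adFn_mem_FPRel hQfp hGfp _,
    adFn_eq hQ hG hFB (window_bound hnum_le)⟩

end FactorWindow

end Literature.Computability.Cryptography
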